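import Summits.QuantumFields.BalabanUV.Beta.MultiscaleCombesThomasCovariant

/-!
# `Summit.QuantumFields.BalabanUV.Beta.MultiscaleCombesThomasAveraging` — the SITEWISE conjugation defect of a COVARIANT
# BLOCK-AVERAGING Gram term `QᴴQ`, `Q = Qm (covFamily t R)` (scalar block profiles `t_y`, isometric fibre transports `R_y(x)`),
# EXACT (`Re conjForm = Σ_y (‖A_y‖² − ‖B_y‖²)`, cosh∕sinh parts) and FIBRE-DIMENSION-FREE: `QᴴQ` costs, AT EACH SITE `x`, only
# `Σ_y (2(cosh κω_y − 1) + sinh² κω_y)·s_y·|t_y(x)| ≤ 5κ²·Σ_y ω_y²·s_y|t_y(x)|` — SECOND order in the oscillation `ω_y` of the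
# weight over the block `y`; with file 3 the END for `covLap μ W + QᴴQ` = the multi-region averaged operator's SHAPE (file 4; v1.0.1)

HONEST FRAMING (page 1 of everything in this cell).  Discharging `FlowStep.BetaPertH` would make Bałaban's
ultraviolet stability UNCONDITIONAL — a constructive-QFT result; it is NOT the continuum limit and NOT the Clay
problem.  This module discharges nothing of `BetaPertH`; it is ELEMENTARY finite-dimensional linear algebra ([folklore]:
the Combes–Thomas ∕ Agmon conjugation of a block-averaging Gram operator, computed block by block), kernel-checked, written
by the OWNER of binder row D4 (unit `b2b-balaban-beta-an4`, gen 42; claim «MULTISCALE-CT-LOCAL», journal l.17755) for NODE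
O.2 item (v) «k-UNIFORM constants», DECAY half — in the currency of the lineage's E-I3 chain (`CoarseCoerciveTransport.covFamily`,
`UnitLatticeResolventWalk.Qm`, `CoarseCoerciveCovariantLaplacian.covLap`).  HONEST DEPENDENCY: continuum YM on T⁴ ⇐ BetaPertH ∧
nine spine estimates (0/9 proved); BetaPertH ⇐ (D1) ∧ (D4) ∧ CAP+tail; G-an2-4 gates asym, D1 and NE2/3/4.

WHY THIS FILE.  File 3 (`MultiscaleCombesThomasCovariant`) prices the covariant Laplacian sitewise and leaves the positive part
`P` of `covLap μ W + P` with a displayed sitewise budget `J′`.  For the multi-region operator `Δ_U + Σ_j a_jG_jᵀG_j` of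
[Balaban1985BackgroundPropagators] (3.24) p. 394 (SHAPE; pv21 `levelOp`, the co-owner's `MultiscaleCoercive`) `P` is a sum of
block-averaging Gram terms; this file computes their sitewise budget through the block structure (NOT through the generic
component-indexed cosh budget, which would cost a `√|Cp|` per transport) and is the matrix-currency template of the «sitewise
`qPart_ge`» named as the MODEL-side residual in the owner's XREAD C-an4-129 (INFO-2).  The level weights `a_j ≥ 0` are absorbed
in the profiles (`t ↦ √a·t`).

CONTENT (all [folklore]; hypothesis SHAPES written out, no `Prop`-valued definitions).
* §1 `slice_Qm_covFamily_mulVec` (`(Qf)_y = Σ_x t_y(x)·R_y(x)·f_x`), the block sum `Spart` (`= (Qz)_y`), the cosh∕sinh parts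
  `Apart`∕`Bpart` of the weighted block sums about a base value `c_y`, `slice_Q_wt` (`(Q e^{±κφ}z)_y = e^{±κc_y}·(A_y ± B_y)`), and
  the EXACT identity **`re_conjForm_avgGram`**: `Re conjForm (QᴴQ) κ (φ∘fst) z = Σ_y (nsq A_y − nsq B_y)`.
* §2 bounds for isometric `R` (`R_y(x)ᵀR_y(x) = 1`): `l2_sum_smul_mulVec_le`; with `cosh κ(φ_x − c_y) − 1 ≤ η_y` and
  `|sinh κ(φ_x − c_y)| ≤ sh_y` on the support of `t_y`: `l2 (A_y − S_y) ≤ η_y·m_y`, `l2 B_y ≤ sh_y·m_y`, `l2 S_y ≤ m_y`,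
  `m_y = Σ_x|t_y(x)|·l2 z_x`, `m_y² ≤ s_y·M_y` (`s_y = Σ_x|t_y(x)|`, `M_y = Σ_x |t_y(x)|·nsq z_x`, Cauchy–Schwarz); per block
  `nsq A_y − nsq B_y ≥ nsq S_y − (2η_y + sh_y²)·s_y·M_y` (`cell_lower`).
* §3 **`localLower_avgGram`**: `Re z*(QᴴQ)z − Σ_p J′(p.1)‖z_p‖² ≤ Re conjForm (QᴴQ) κ (φ∘fst) z`,
  `J′ x = Σ_y (2η_y + sh_y²)·s_y·|t_y(x)|` — no `|Cp|`, no `sup`.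
* §4 SCALE-ADAPTED: `|φ_x − c_y| ≤ ω_y` on the support of `t_y`, `0 ≤ κ`, `κω_y ≤ 1` ⟹ `η_y = cosh κω_y − 1 ≤ (κω_y)²`,
  `sh_y = sinh κω_y`, `sh_y² ≤ 3(κω_y)²` ⟹ **`localLower_avgGram_osc`** with `J′ x ≤ 5κ²·Σ_y ω_y²·s_y|t_y(x)|`; and the END
  **`norm_inv_apply_le_multiregion`** for `A = covLap μ src tgt W + QᴴQ`: local coercivity `λ > 0`, bond steps `ℓ_b(q)`, block
  oscillations `ω_y(q)` about bases `c_y(q)`, budget `κ²Σ_{b∋x}ℓ_b(q)² + 5κ²Σ_y ω_y(q)²s_y|t_y(x)| ≤ λ_{(x,i)}/2` ⟹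
  `‖A⁻¹(p,q)‖ ≤ 2e^{−κφ_q(x_p)}/√(λ_pλ_q)` — file 3's `norm_inv_apply_le_covLap_add` BY NAME.  In print's normalisation (block means
  of side-`n` cells, `t_y = √a_l·n^{−ν}𝟙_y`, `a_l n^{−ν−2}`-type scaling: `s_y|t_y(x)| ≍ a/n²`; weight step `δ/n` per bond ⟹
  `ω_y ≤ νδ`) both costs are `≍ κ²δ²/n²` on the SAME scale as `λ ≍ κ₀/n²`: the smallness condition is on `κδ` ALONE — level-count-
  and volume-free ([Balaban1985BackgroundPropagators] Thm 3.1 (3.42) p. 397, locator only: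
  (3.42)'s local-prefactor shape at the ENTRY ∕ ℓ²-pairing level ONLY — print's (3.42) is a sup-norm operator bound with ONE prefactor `(L^jη)²` at the target and the source in sup norm over a cube `Δ(y′)`, and the entry → sup transfer is NOT level-free; the level-free statement for such consumers is the ℓ²-pairing bound `combesThomas_local`, the local `ℓ² → ℓ^∞` step being O.2 item (ii) (v1.0.1 DOCFIX, d4-p3 XREAD C-d4p3-28 INFO-1)).

ABSOLUTE RULE.  Nothing printed is cited as a fact; no manuscript statement enters as a hypothesis; (3.24) ∕ (3.42) are
LOCATORS.  Nothing of Bałaban's operators is instantiated; no weight, bases, cells or torus are constructed (instance data,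
MODEL lane).  Declarations of files 1–3, of the lineage's `CoarseCoerciveTransport`∕`CoarseCoerciveCovariantEnergy`∕`…Laplacian`,
of d4-p3's `UnitLatticeResolventWalk.Qm`, of `QuantumLattice` and of b05's `B5Prop11Lower` are used BY NAME, never restated.
Row D4: abstract engine, file 4; class of (T3) ∕ NODE O.2 UNCHANGED (critical-path width 0); D4 DISCHARGE NO DATE; NOT
BetaPertH, NOT continuum, NOT Clay, NOT summit progress.
-/

open scoped BigOperators Matrix ComplexConjugate
open Finset Complex Matrix

namespace Summit.QuantumFields.BalabanUV.Beta.MultiscaleCombesThomasAveraging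

open Summit.QuantumFields.BalabanUV.Beta.AccretiveCombesThomas
open Summit.QuantumFields.BalabanUV.Beta.MultiscaleCombesThomas
open Summit.QuantumFields.BalabanUV.Beta.MultiscaleCombesThomasBudget
open Summit.QuantumFields.BalabanUV.Beta.MultiscaleCombesThomasCovariant
open Summit.QuantumFields.BalabanUV.Beta.UnitLatticeResolventWalk (Qm)
open Summit.QuantumFields.BalabanUV.Beta.CoarseCoerciveTransport (covFamily)
open Summit.QuantumFields.BalabanUV.Beta.CoarseCoerciveCovariantEnergy (l2 l2_sq l2_nonneg l2_add_le l2_sum_le l2_smul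
  cpx cpx_apply slice nsq_eq_sum_slice covDiff nsq_mulVec_cpx l2_mulVec_cpx l2_eq_sqrt)
open Summit.QuantumFields.BalabanUV.Beta.CoarseCoerciveCovariantLaplacian (covLap)
open Literature.MathematicalPhysics.QuantumFieldTheory.Balaban1983to89.B5Prop11Lower (nsq nsq_nonneg
  norm_star_dotProduct_le star_dotProduct_self)

noncomputable section

variable {S Cp μ ι : Type*} [Fintype S] [Fintype Cp]

/-! ## §1 Block sums, their cosh∕sinh parts, and the exact identity -/

/-- **The averaging operator fibrewise**: `(Q f)_y = Σ_x t_y(x)·R_y(x)·f_x` for `Q = Qm (covFamily t R)`. [folklore] -/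
theorem slice_Qm_covFamily_mulVec [DecidableEq Cp] (t : μ → S → ℝ) (R : μ → S → Matrix Cp Cp ℝ) (f : S × Cp → ℂ)
    (y : μ) : slice (Qm (covFamily t R) *ᵥ f) y = ∑ x, ((t y x : ℝ) : ℂ) • (cpx (R y x) *ᵥ slice f x) := by
  ext a
  rw [Finset.sum_apply]
  simp only [CoarseCoerciveCovariantEnergy.slice, Pi.smul_apply, smul_eq_mul, Matrix.mulVec, dotProduct, cpx_apply,
    Finset.mul_sum]
  rw [Fintype.sum_prod_type]
  refine Finset.sum_congr rfl fun x _ => Finset.sum_congr rfl fun i _ => ?_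
  rw [show Qm (covFamily t R) (y, a) (x, i) = (starRingEnd ℂ) (((t y x * R y x a i : ℝ) : ℂ)) from rfl,
    Complex.conj_ofReal]
  push_cast
  ring

/-- The block sum `S_y = (Qz)_y = Σ_x t_y(x)·R_y(x)·z_x`. [folklore] -/
def Spart [DecidableEq Cp] (t : μ → S → ℝ) (R : μ → S → Matrix Cp Cp ℝ) (z : S × Cp → ℂ) (y : μ) : Cp → ℂ :=
  ∑ x, ((t y x : ℝ) : ℂ) • (cpx (R y x) *ᵥ slice z x)

/-- The cosh part `A_y = Σ_x t_y(x)·cosh κ(φ_x − c_y)·R_y(x)·z_x` of the weighted block sums about the base value `c_y`. [folklore] -/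
def Apart [DecidableEq Cp] (t : μ → S → ℝ) (R : μ → S → Matrix Cp Cp ℝ) (κ : ℝ) (φ : S → ℝ) (c : μ → ℝ) (z : S × Cp → ℂ) (y : μ) :
    Cp → ℂ :=
  ∑ x, ((t y x * Real.cosh (κ * (φ x - c y)) : ℝ) : ℂ) • (cpx (R y x) *ᵥ slice z x)

/-- The sinh part `B_y = Σ_x t_y(x)·sinh κ(φ_x − c_y)·R_y(x)·z_x`. [folklore] -/
def Bpart [DecidableEq Cp] (t : μ → S → ℝ) (R : μ → S → Matrix Cp Cp ℝ) (κ : ℝ) (φ : S → ℝ) (c : μ → ℝ) (z : S × Cp → ℂ) (y : μ) :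
    Cp → ℂ :=
  ∑ x, ((t y x * Real.sinh (κ * (φ x - c y)) : ℝ) : ℂ) • (cpx (R y x) *ᵥ slice z x)

/-- `S_y` is the slice of `Qz`. [folklore] -/
theorem slice_Q_eq_Spart [DecidableEq Cp] (t : μ → S → ℝ) (R : μ → S → Matrix Cp Cp ℝ) (z : S × Cp → ℂ) (y : μ) :
    slice (Qm (covFamily t R) *ᵥ z) y = Spart t R z y :=
  slice_Qm_covFamily_mulVec t R z y

/-- **The weighted block sums**: `(Q e^{κφ}z)_y = e^{κc_y}·(A_y + B_y)` and `(Q e^{−κφ}z)_y = e^{−κc_y}·(A_y − B_y)`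
(`e^{±σ} = cosh σ ± sinh σ`). [folklore] -/
theorem slice_Q_wt [DecidableEq Cp] (t : μ → S → ℝ) (R : μ → S → Matrix Cp Cp ℝ) (κ : ℝ) (φ : S → ℝ) (c : μ → ℝ) (z : S × Cp → ℂ)
    (y : μ) :
    slice (Qm (covFamily t R) *ᵥ wt κ (fun p : S × Cp => φ p.1) z) y =
        ((Real.exp (κ * c y) : ℝ) : ℂ) • (Apart t R κ φ c z y + Bpart t R κ φ c z y) ∧
      slice (Qm (covFamily t R) *ᵥ wt (-κ) (fun p : S × Cp => φ p.1) z) y =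
        ((Real.exp (-(κ * c y)) : ℝ) : ℂ) • (Apart t R κ φ c z y - Bpart t R κ φ c z y) := by
  constructor
  · rw [slice_Qm_covFamily_mulVec, Apart, Bpart, ← Finset.sum_add_distrib, Finset.smul_sum]
    refine Finset.sum_congr rfl fun x _ => ?_
    rw [slice_wt, Matrix.mulVec_smul, smul_smul, ← add_smul, smul_smul]
    congr 1
    have h : Real.exp (κ * φ x) = Real.exp (κ * c y) * (Real.cosh (κ * (φ x - c y)) + Real.sinh (κ * (φ x - c y))) := by
      rw [Real.cosh_add_sinh, ← Real.exp_add]; ring_nf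
    rw [h]; push_cast; ring
  · rw [slice_Qm_covFamily_mulVec, Apart, Bpart, ← Finset.sum_sub_distrib, Finset.smul_sum]
    refine Finset.sum_congr rfl fun x _ => ?_
    rw [slice_wt, Matrix.mulVec_smul, smul_smul, ← sub_smul, smul_smul]
    congr 1
    have h : Real.exp (-κ * φ x) =
        Real.exp (-(κ * c y)) * (Real.cosh (κ * (φ x - c y)) - Real.sinh (κ * (φ x - c y))) := by
      rw [Real.cosh_sub_sinh, ← Real.exp_add]; ring_nf
    rw [h]; push_cast; ring

omit [Fintype S] in
/-- `Re⟨a(A+B), a′(A−B)⟩ = nsq A − nsq B` for real `a, a′` with `a·a′ = 1`. [folklore] -/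
theorem re_pair_cosh_sinh (A B : Cp → ℂ) {a a' : ℝ} (h : a * a' = 1) :
    (star (((a : ℝ) : ℂ) • (A + B)) ⬝ᵥ ((((a' : ℝ) : ℂ)) • (A - B))).re = nsq A - nsq B := by
  have hexp : star (((a : ℝ) : ℂ) • (A + B)) ⬝ᵥ ((((a' : ℝ) : ℂ)) • (A - B)) =
      ((a * a' : ℝ) : ℂ) * (star A ⬝ᵥ A - star A ⬝ᵥ B + star B ⬝ᵥ A - star B ⬝ᵥ B) := by
    simp only [dotProduct, Pi.star_apply, Pi.add_apply, Pi.sub_apply, Pi.smul_apply, smul_eq_mul, star_add, star_mul',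
      Complex.star_def, Complex.conj_ofReal, Finset.mul_sum, ← Finset.sum_add_distrib, ← Finset.sum_sub_distrib]
    refine Finset.sum_congr rfl fun i _ => ?_
    push_cast; ring
  rw [hexp, h, star_dotProduct_self, star_dotProduct_self]
  push_cast
  simp only [one_mul, Complex.sub_re, Complex.add_re, Complex.ofReal_re, re_star_dotProduct_comm A B]
  ring

/-- **THE EXACT IDENTITY for the averaging Gram term**: `Re conjForm (QᴴQ) κ (φ∘fst) z = Σ_y (nsq A_y − nsq B_y)`. [folklore] -/
theorem re_conjForm_avgGram [Fintype μ] [DecidableEq Cp] (t : μ → S → ℝ) (R : μ → S → Matrix Cp Cp ℝ) (κ : ℝ) (φ : S → ℝ) (c : μ → ℝ)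
    (z : S × Cp → ℂ) :
    (conjForm ((Qm (covFamily t R))ᴴ * Qm (covFamily t R)) κ (fun p : S × Cp => φ p.1) z).re =
      ∑ y, (nsq (Apart t R κ φ c z y) - nsq (Bpart t R κ φ c z y)) := by
  rw [conjForm_gram]
  have hsplit : ∀ (f g : μ × Cp → ℂ), star f ⬝ᵥ g = ∑ y, star (slice f y) ⬝ᵥ slice g y := by
    intro f g
    rw [dotProduct, Fintype.sum_prod_type]
    rfl
  rw [hsplit, Complex.re_sum]
  refine Finset.sum_congr rfl fun y _ => ?_
  rw [(slice_Q_wt t R κ φ c z y).1, (slice_Q_wt t R κ φ c z y).2]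
  exact re_pair_cosh_sinh _ _ (by rw [← Real.exp_add, add_neg_cancel, Real.exp_zero])

/-! ## §2 Bounds for isometric transports -/

/-- `l2 (Σ_x α_x·R_x·v_x) ≤ Σ_x |α_x|·l2 v_x` for isometric `R_x`. [folklore] -/
theorem l2_sum_smul_mulVec_le [DecidableEq Cp] (α : S → ℝ) (Rx : S → Matrix Cp Cp ℝ) (hR : ∀ x, (Rx x)ᵀ * Rx x = 1)
    (v : S → Cp → ℂ) : l2 (∑ x, ((α x : ℝ) : ℂ) • (cpx (Rx x) *ᵥ v x)) ≤ ∑ x, |α x| * l2 (v x) := by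
  refine (l2_sum_le _ _).trans (Finset.sum_le_sum fun x _ => ?_)
  rw [l2_smul, Complex.norm_real, Real.norm_eq_abs, l2_mulVec_cpx _ (hR x)]

/-- The block ℓ¹-moment `m_y = Σ_x |t_y(x)|·l2 z_x`. [folklore] -/
def mom (t : μ → S → ℝ) (z : S × Cp → ℂ) (y : μ) : ℝ := ∑ x, |t y x| * l2 (slice z x)

/-- The block mass `s_y = Σ_x |t_y(x)|`. [folklore] -/
def bmass (t : μ → S → ℝ) (y : μ) : ℝ := ∑ x, |t y x|

/-- The weighted fibre mass `M_y = Σ_x |t_y(x)|·nsq z_x`. [folklore] -/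
def wmass (t : μ → S → ℝ) (z : S × Cp → ℂ) (y : μ) : ℝ := ∑ x, |t y x| * nsq (slice z x)

/-- `m_y ≥ 0`. [folklore] -/
theorem mom_nonneg (t : μ → S → ℝ) (z : S × Cp → ℂ) (y : μ) : 0 ≤ mom t z y :=
  Finset.sum_nonneg fun _ _ => mul_nonneg (abs_nonneg _) (l2_nonneg _)

/-- **Cauchy–Schwarz**: `m_y² ≤ s_y·M_y`. [folklore] -/
theorem mom_sq_le (t : μ → S → ℝ) (z : S × Cp → ℂ) (y : μ) : mom t z y ^ 2 ≤ bmass t y * wmass t z y := by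
  have h := Finset.sum_mul_sq_le_sq_mul_sq Finset.univ (fun x => Real.sqrt |t y x|)
    (fun x => Real.sqrt |t y x| * l2 (slice z x))
  have hsq : ∀ x, Real.sqrt |t y x| ^ 2 = |t y x| := fun x => Real.sq_sqrt (abs_nonneg _)
  simp only [mul_pow, hsq, ← mul_assoc] at h
  simp only [← sq, hsq, l2_sq] at h
  exact h

section Iso

variable [DecidableEq Cp] (t : μ → S → ℝ) (R : μ → S → Matrix Cp Cp ℝ) (hR : ∀ y x, (R y x)ᵀ * R y x = 1) (κ : ℝ) (φ : S → ℝ)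
  (c : μ → ℝ) (η sh : μ → ℝ) (hη0 : ∀ y, 0 ≤ η y)
  (hη : ∀ y x, t y x ≠ 0 → Real.cosh (κ * (φ x - c y)) - 1 ≤ η y)
  (hsh : ∀ y x, t y x ≠ 0 → |Real.sinh (κ * (φ x - c y))| ≤ sh y)
include hR

/-- `l2 S_y ≤ m_y`. [folklore] -/
theorem l2_Spart_le (z : S × Cp → ℂ) (y : μ) : l2 (Spart t R z y) ≤ mom t z y :=
  l2_sum_smul_mulVec_le (t y) (R y) (hR y) (slice z)

include hη in
/-- `l2 (A_y − S_y) ≤ η_y·m_y` (the cosh part is second-order close to the block sum). [folklore] -/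
theorem l2_Apart_sub_Spart_le (z : S × Cp → ℂ) (y : μ) : l2 (Apart t R κ φ c z y - Spart t R z y) ≤ η y * mom t z y := by
  have hdiff : Apart t R κ φ c z y - Spart t R z y =
      ∑ x, (((t y x * (Real.cosh (κ * (φ x - c y)) - 1)) : ℝ) : ℂ) • (cpx (R y x) *ᵥ slice z x) := by
    rw [Apart, Spart, ← Finset.sum_sub_distrib]
    refine Finset.sum_congr rfl fun x _ => ?_
    rw [← sub_smul]; push_cast; ring_nf
  rw [hdiff, mom, Finset.mul_sum]
  refine (l2_sum_smul_mulVec_le _ (R y) (hR y) (slice z)).trans (Finset.sum_le_sum fun x _ => ?_)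
  by_cases h0 : t y x = 0
  · simp [h0]
  · have hc : 0 ≤ Real.cosh (κ * (φ x - c y)) - 1 := by linarith [Real.one_le_cosh (κ * (φ x - c y))]
    rw [abs_mul, abs_of_nonneg hc]
    calc |t y x| * (Real.cosh (κ * (φ x - c y)) - 1) * l2 (slice z x)
        ≤ |t y x| * η y * l2 (slice z x) := by gcongr; exact l2_nonneg _; exact hη y x h0
      _ = η y * (|t y x| * l2 (slice z x)) := by ring

include hsh in
/-- `l2 B_y ≤ sh_y·m_y`. [folklore] -/
theorem l2_Bpart_le (z : S × Cp → ℂ) (y : μ) : l2 (Bpart t R κ φ c z y) ≤ sh y * mom t z y := by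
  rw [Bpart, mom, Finset.mul_sum]
  refine (l2_sum_smul_mulVec_le _ (R y) (hR y) (slice z)).trans (Finset.sum_le_sum fun x _ => ?_)
  by_cases h0 : t y x = 0
  · simp [h0]
  · rw [abs_mul]
    calc |t y x| * |Real.sinh (κ * (φ x - c y))| * l2 (slice z x) ≤ |t y x| * sh y * l2 (slice z x) := by
          gcongr; exact l2_nonneg _; exact hsh y x h0
      _ = sh y * (|t y x| * l2 (slice z x)) := by ring

include hη0 hη hsh in
/-- **Per block**: `nsq A_y − nsq B_y ≥ nsq S_y − (2η_y + sh_y²)·s_y·M_y`. [folklore] -/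
theorem cell_lower (z : S × Cp → ℂ) (y : μ) :
    nsq (Spart t R z y) - (2 * η y + sh y ^ 2) * (bmass t y * wmass t z y) ≤
      nsq (Apart t R κ φ c z y) - nsq (Bpart t R κ φ c z y) := by
  set A := Apart t R κ φ c z y
  set B := Bpart t R κ φ c z y
  set Sy := Spart t R z y
  have hm := mom_nonneg t z y
  have hm2 := mom_sq_le t z y
  have hS := l2_Spart_le t R hR z y
  have hAS := l2_Apart_sub_Spart_le t R hR κ φ c η hη z y
  have hB := l2_Bpart_le t R hR κ φ c sh hsh z y
  -- nsq A ≥ nsq S − 2·l2 S·l2 (A − S)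
  have htri : l2 Sy ≤ l2 A + l2 (A - Sy) := by
    have h := l2_add_le A (Sy - A)
    rw [add_sub_cancel] at h
    have hneg : l2 (Sy - A) = l2 (A - Sy) := by
      rw [l2, l2, ← norm_neg, ← WithLp.toLp_neg, neg_sub]
    linarith [hneg]
  have hA2 : nsq Sy - 2 * l2 Sy * l2 (A - Sy) ≤ nsq A := by
    rw [← l2_sq, ← l2_sq]
    have h0 := l2_nonneg Sy
    have h1 := l2_nonneg A
    have h2 := l2_nonneg (A - Sy)
    by_cases hle : l2 Sy ≤ l2 (A - Sy)
    · nlinarith [mul_le_mul_of_nonneg_left hle h0]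
    · have hle := not_le.mp hle
      have hD : l2 Sy - l2 (A - Sy) ≤ l2 A := by linarith
      have hD0 : 0 ≤ l2 Sy - l2 (A - Sy) := by linarith
      nlinarith [mul_le_mul hD hD hD0 h1]
  have hB2 : nsq B ≤ sh y ^ 2 * mom t z y ^ 2 := by
    rw [← l2_sq, ← mul_pow]
    exact pow_le_pow_left₀ (l2_nonneg _) hB 2
  have hcross : l2 Sy * l2 (A - Sy) ≤ η y * mom t z y ^ 2 := by
    calc l2 Sy * l2 (A - Sy) ≤ mom t z y * (η y * mom t z y) :=
          mul_le_mul hS hAS (l2_nonneg _) hm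
      _ = η y * mom t z y ^ 2 := by ring
  have hsM : 0 ≤ bmass t y * wmass t z y :=
    mul_nonneg (Finset.sum_nonneg fun _ _ => abs_nonneg _)
      (Finset.sum_nonneg fun _ _ => mul_nonneg (abs_nonneg _) (nsq_nonneg _))
  nlinarith [hη0 y, sq_nonneg (sh y), hm2]

end Iso

/-! ## §3 The sitewise budget of the averaging Gram term -/

/-- Bookkeeping: `Σ_y g_y·s_y·M_y = Σ_p (Σ_y g_y·s_y·|t_y(p.1)|)·‖z_p‖²`. [folklore] -/
theorem sum_wmass_eq [Fintype μ] (t : μ → S → ℝ) (g : μ → ℝ) (z : S × Cp → ℂ) :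
    ∑ y, g y * (bmass t y * wmass t z y) = ∑ p : S × Cp, (∑ y, g y * bmass t y * |t y p.1|) * ‖z p‖ ^ 2 := by
  have hslice : ∀ x, nsq (slice z x) = ∑ i, ‖z (x, i)‖ ^ 2 := fun x => rfl
  rw [Fintype.sum_prod_type]
  simp_rw [← Finset.mul_sum, ← hslice, wmass, Finset.mul_sum, Finset.sum_mul]
  rw [Finset.sum_comm]
  exact Finset.sum_congr rfl fun x _ => Finset.sum_congr rfl fun y _ => by ring

/-- `Re z*(QᴴQ)z = nsq (Qz) = Σ_y nsq S_y`. [folklore] -/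
theorem re_form_avgGram [Fintype μ] [DecidableEq Cp] (t : μ → S → ℝ) (R : μ → S → Matrix Cp Cp ℝ) (z : S × Cp → ℂ) :
    (star z ⬝ᵥ (((Qm (covFamily t R))ᴴ * Qm (covFamily t R)) *ᵥ z)).re = ∑ y, nsq (Spart t R z y) := by
  rw [← Matrix.mulVec_mulVec, Matrix.dotProduct_mulVec, ← Matrix.star_mulVec, star_dotProduct_self, Complex.ofReal_re,
    nsq_eq_sum_slice]
  exact Finset.sum_congr rfl fun y _ => by rw [slice_Q_eq_Spart]

/-- **THE SITEWISE BUDGET of `QᴴQ`** (isometric `R`; `cosh κ(φ_x − c_y) − 1 ≤ η_y`, `|sinh κ(φ_x − c_y)| ≤ sh_y` on the support of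
`t_y`): `Re z*(QᴴQ)z − Σ_p J′(p.1)‖z_p‖² ≤ Re conjForm (QᴴQ) κ (φ∘fst) z` with `J′ x = Σ_y (2η_y + sh_y²)·s_y·|t_y(x)|` — the
shape «costs at most `J′` sitewise» of `MultiscaleCombesThomasBudget`; no fibre-dimension factor, no `sup`. [folklore] -/
theorem localLower_avgGram [Fintype μ] [DecidableEq Cp] (t : μ → S → ℝ) (R : μ → S → Matrix Cp Cp ℝ) (hR : ∀ y x, (R y x)ᵀ * R y x = 1) (κ : ℝ)
    (φ : S → ℝ) (c : μ → ℝ) (η sh : μ → ℝ) (hη0 : ∀ y, 0 ≤ η y)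
    (hη : ∀ y x, t y x ≠ 0 → Real.cosh (κ * (φ x - c y)) - 1 ≤ η y)
    (hsh : ∀ y x, t y x ≠ 0 → |Real.sinh (κ * (φ x - c y))| ≤ sh y) (z : S × Cp → ℂ) :
    (star z ⬝ᵥ (((Qm (covFamily t R))ᴴ * Qm (covFamily t R)) *ᵥ z)).re -
        ∑ p : S × Cp, (∑ y, (2 * η y + sh y ^ 2) * bmass t y * |t y p.1|) * ‖z p‖ ^ 2 ≤
      (conjForm ((Qm (covFamily t R))ᴴ * Qm (covFamily t R)) κ (fun p : S × Cp => φ p.1) z).re := by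
  have hJ : ∑ y, (2 * η y + sh y ^ 2) * (bmass t y * wmass t z y) =
      ∑ p : S × Cp, (∑ y, (2 * η y + sh y ^ 2) * bmass t y * |t y p.1|) * ‖z p‖ ^ 2 :=
    sum_wmass_eq t (fun y => 2 * η y + sh y ^ 2) z
  rw [re_form_avgGram, re_conjForm_avgGram t R κ φ c, ← hJ, ← Finset.sum_sub_distrib]
  exact Finset.sum_le_sum fun y _ => cell_lower t R hR κ φ c η sh hη0 hη hsh z y

/-! ## §4 Scale-adapted block oscillations and the END for the multi-region shape -/

omit [Fintype S] [Fintype Cp] in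
/-- `sinh² u ≤ 3u²` for `|u| ≤ 1` (`sinh² = (cosh − 1)(cosh + 1)`, `cosh − 1 ≤ u²`). [folklore] -/
theorem sinh_sq_le {u : ℝ} (hu : |u| ≤ 1) : Real.sinh u ^ 2 ≤ 3 * u ^ 2 := by
  have hc := Literature.MathematicalPhysics.QuantumLattice.cosh_sub_one_le_sq_of_abs_le_one hu
  have hu2 : u ^ 2 ≤ 1 := by
    have := abs_le.mp hu
    nlinarith
  rw [Real.sinh_sq]
  nlinarith [Real.one_le_cosh u]

/-- **Sitewise budget from block oscillations**: `|φ_x − c_y| ≤ ω_y` on the support of `t_y`, `0 ≤ κ`, `0 ≤ ω_y`, `κω_y ≤ 1`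
⟹ `QᴴQ` costs at most `5κ²·Σ_y ω_y²·s_y·|t_y(x)|` at every site over `x`. [folklore] -/
theorem localLower_avgGram_osc [Fintype μ] [DecidableEq Cp] (t : μ → S → ℝ) (R : μ → S → Matrix Cp Cp ℝ) (hR : ∀ y x, (R y x)ᵀ * R y x = 1)
    {κ : ℝ} (hκ : 0 ≤ κ) (φ : S → ℝ) (c ω : μ → ℝ) (hω0 : ∀ y, 0 ≤ ω y)
    (hω : ∀ y x, t y x ≠ 0 → |φ x - c y| ≤ ω y) (h1 : ∀ y, κ * ω y ≤ 1) (z : S × Cp → ℂ) :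
    (star z ⬝ᵥ (((Qm (covFamily t R))ᴴ * Qm (covFamily t R)) *ᵥ z)).re -
        ∑ p : S × Cp, (5 * κ ^ 2 * ∑ y, ω y ^ 2 * bmass t y * |t y p.1|) * ‖z p‖ ^ 2 ≤
      (conjForm ((Qm (covFamily t R))ᴴ * Qm (covFamily t R)) κ (fun p : S × Cp => φ p.1) z).re := by
  have hκω : ∀ y, |κ * ω y| ≤ 1 := fun y => by
    rw [abs_of_nonneg (mul_nonneg hκ (hω0 y))]; exact h1 y
  have harg : ∀ y x, t y x ≠ 0 → |κ * (φ x - c y)| ≤ |κ * ω y| := fun y x h0 => by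
    rw [abs_mul, abs_mul, abs_of_nonneg hκ]
    exact mul_le_mul_of_nonneg_left ((hω y x h0).trans (le_abs_self _)) hκ
  have hη : ∀ y x, t y x ≠ 0 → Real.cosh (κ * (φ x - c y)) - 1 ≤ Real.cosh (κ * ω y) - 1 := fun y x h0 => by
    linarith [Real.cosh_le_cosh.mpr (harg y x h0)]
  have hsh : ∀ y x, t y x ≠ 0 → |Real.sinh (κ * (φ x - c y))| ≤ Real.sinh (κ * ω y) := fun y x h0 => by
    rw [Real.abs_sinh]
    have := harg y x h0
    rw [abs_of_nonneg (mul_nonneg hκ (hω0 y))] at this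
    exact Real.sinh_le_sinh.mpr this
  have hη0 : ∀ y, 0 ≤ Real.cosh (κ * ω y) - 1 := fun y => by linarith [Real.one_le_cosh (κ * ω y)]
  have h := localLower_avgGram t R hR κ φ c (fun y => Real.cosh (κ * ω y) - 1) (fun y => Real.sinh (κ * ω y)) hη0 hη hsh z
  refine le_trans ?_ h
  have hcoef : ∀ x, 5 * κ ^ 2 * ∑ y, ω y ^ 2 * bmass t y * |t y x| ≥
      ∑ y, (2 * (Real.cosh (κ * ω y) - 1) + Real.sinh (κ * ω y) ^ 2) * bmass t y * |t y x| := by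
    intro x
    rw [ge_iff_le, Finset.mul_sum]
    refine Finset.sum_le_sum fun y _ => ?_
    have hg : 2 * (Real.cosh (κ * ω y) - 1) + Real.sinh (κ * ω y) ^ 2 ≤ 5 * (κ * ω y) ^ 2 := by
      have h1' := Literature.MathematicalPhysics.QuantumLattice.cosh_sub_one_le_sq_of_abs_le_one (hκω y)
      have h2' := sinh_sq_le (hκω y)
      linarith
    have hb : 0 ≤ bmass t y * |t y x| := mul_nonneg (Finset.sum_nonneg fun _ _ => abs_nonneg _) (abs_nonneg _)
    calc (2 * (Real.cosh (κ * ω y) - 1) + Real.sinh (κ * ω y) ^ 2) * bmass t y * |t y x|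
        = (2 * (Real.cosh (κ * ω y) - 1) + Real.sinh (κ * ω y) ^ 2) * (bmass t y * |t y x|) := by ring
      _ ≤ 5 * (κ * ω y) ^ 2 * (bmass t y * |t y x|) := mul_le_mul_of_nonneg_right hg hb
      _ = 5 * κ ^ 2 * (ω y ^ 2 * bmass t y * |t y x|) := by ring
  linarith [Finset.sum_le_sum fun p (_ : p ∈ (Finset.univ : Finset (S × Cp))) =>
    mul_le_mul_of_nonneg_right (hcoef p.1) (sq_nonneg ‖z p‖)]

/-- **THE END FOR THE MULTI-REGION SHAPE `A = covLap μ src tgt W + QᴴQ`** (`Q = Qm (covFamily t R)`; isometric `W_b` and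
`R_y(x)`; level weights absorbed in `t`): `A` locally coercive with profile `λ > 0`; column weights `φ_q` read through the site
with `φ_q(x_q) = 0`, bond steps `|φ_q(tgt b) − φ_q(src b)| ≤ ℓ_b(q)` (`κℓ ≤ 1`), block oscillations `|φ_q(x) − c_y(q)| ≤ ω_y(q)` on
the support of `t_y` (`0 ≤ ω`, `κω ≤ 1`), and the sitewise budget
`κ²Σ_b([tgt b = x] + [src b = x])ℓ_b(q)² + 5κ²Σ_y ω_y(q)²s_y|t_y(x)| ≤ λ_{(x,i)}/2` ⟹ `‖A⁻¹(p,q)‖ ≤ 2e^{−κφ_q(x_p)}/√(λ_pλ_q)`.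
[cite: Balaban1985BackgroundPropagators, Thm 3.1 (3.42) p.397] [folklore] -/
theorem norm_inv_apply_le_multiregion [Fintype μ] [Fintype ι] [DecidableEq S] [DecidableEq Cp] (μ0 : ℝ) (src tgt : ι → S) (W : ι → Matrix Cp Cp ℝ) (hW : ∀ b, (W b)ᵀ * W b = 1)
    (t : μ → S → ℝ) (R : μ → S → Matrix Cp Cp ℝ) (hR : ∀ y x, (R y x)ᵀ * R y x = 1)
    {κ : ℝ} (hκ : 0 ≤ κ) (φ : S × Cp → S → ℝ) (hφ0 : ∀ q, φ q q.1 = 0) (ℓ : S × Cp → ι → ℝ)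
    (hφ : ∀ q b, |φ q (tgt b) - φ q (src b)| ≤ ℓ q b) (h1 : ∀ q b, κ * ℓ q b ≤ 1)
    (c ω : S × Cp → μ → ℝ) (hω0 : ∀ q y, 0 ≤ ω q y) (hω : ∀ q y x, t y x ≠ 0 → |φ q x - c q y| ≤ ω q y)
    (h1' : ∀ q y, κ * ω q y ≤ 1) (lam : S × Cp → ℝ) (hlam : ∀ p, 0 < lam p)
    (hA : ∀ z : S × Cp → ℂ, ∑ p, lam p * ‖z p‖ ^ 2 ≤
      (star z ⬝ᵥ ((covLap μ0 src tgt W + (Qm (covFamily t R))ᴴ * Qm (covFamily t R)) *ᵥ z)).re)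
    (hsmall : ∀ q p, κ ^ 2 * ∑ b, ((if tgt b = p.1 then ℓ q b ^ 2 else 0) + (if src b = p.1 then ℓ q b ^ 2 else 0))
      + 5 * κ ^ 2 * ∑ y, ω q y ^ 2 * bmass t y * |t y p.1| ≤ lam p / 2)
    (p q : S × Cp) :
    ‖(covLap μ0 src tgt W + (Qm (covFamily t R))ᴴ * Qm (covFamily t R))⁻¹ p q‖ ≤
      2 * Real.exp (-(κ * φ q p.1)) / Real.sqrt (lam p * lam q) :=
  norm_inv_apply_le_covLap_add μ0 src tgt W hW _ hκ φ hφ0 ℓ hφ h1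
    (fun q p => 5 * κ ^ 2 * ∑ y, ω q y ^ 2 * bmass t y * |t y p.1|)
    (fun q z => localLower_avgGram_osc t R hR hκ (φ q) (c q) (ω q) (hω0 q) (hω q) (h1' q) z) lam hlam hA hsmall p q

end

end Summit.QuantumFields.BalabanUV.Beta.MultiscaleCombesThomasAveraging
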